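import Summits.QuantumFields.BalabanUV.T4Continuum.Spine.NE1p.DressedTransportAssembledMod
import Summits.QuantumFields.BalabanUV.T4Continuum.Spine.NE1p.DressedTransportAssembledData

/-!
# T⁴ programme, spine estimate NE1′ (node O3b/H2) — END-F′-mod OVER CANONICAL DATA: the moduli face of the assembled transport leaf
# with NO bookkeeping functions displayed (swarm row S2 «END-F′ plumbing» of `t4/formal/NE1p/LEAVES.md`, supplier item S2i
# «mod ∘ canonical» of the same seat; the «canonical» factor of the terminal object of `t4/formal/NE1p/DAG.md` v1.3 §3)

Cell `pub-balaban`, sub-cell `t4`, BINDER-OWNERS row NE1′, NE1′ FORMALISATION SWARM `b2b-balaban-t4-ne1p-formalise-*`, leaf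
prover 01 (unit `b2b-balaban-t4-ne1p-formalise-leaf-01`, gen 2); owner lineage t4-ne1p-p1 (skeleton `t4/skeletons/NE1p-t4-ne1p-p1.md`
v1.1 §6 seat S2); tree target `Summits/QuantumFields/BalabanUV/T4Continuum/Spine/NE1p/`; ADDITIVE — imports leaf-08's moduli face
`Spine/NE1p/DressedTransportAssembledMod` (END-F′-mod `transportLeaf_assembled_mod`, p213245) and this seat's
`Spine/NE1p/DressedTransportAssembledData` (the canonical radius `rsOf`, p212730) ONLY; modifies nothing.

WHY.  END-F′-mod (leaf-08, supplier «R-a′» to row S2; finding F-ne1pleaf08-1 dissolved: no radius floor, cutoff-free source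
condition `‖c b k‖ ≤ m`) still carries three FREE bookkeeping functions constrained by equalities «the instantiation defines»:
the step budget `s1` (`hs1`, now a CLOSED form in the booking currency — the moduli `4/r·stepProd α k″ k·gen`), the slice sizes
`Asz` (`hAsz_birth`/`hAsz_step`) and the slice radii `rs` (`hrs_birth`/`hrs_step`, ordered by `hrs_dec`).  On the moduli face
`s1` no longer depends on `Asz`, so — unlike END-F″ (`DressedTransportAssembledData`, where a JOINT recursion was needed) — the
three functions are determined by PLAIN recursions on the scale from the data `(gen, s, c, Sg, δf, α, ϱ, r)`.  This file performs
them once, so that the instantiation-facing form of the moduli face displays the wall binders and the schedule, nothing else: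
* §1 [data] `aszRec gen s s1` — the plain size recursion (`= gen f k″` at scales `k ≤ k″`, `× e^{3(s f k + s1 f k)}` per later
  step) with `aszRec_of_le`/`aszRec_birth`/`aszRec_succ` [arith]; `s1Mod r α gen c Sg δf` — the modulus-form step budget AS A
  DEFINITION, `s1Mod_eq` [arith].  (`rsOf r ϱ` with `rsOf_birth`/`rsOf_succ` is imported from END-F″.)
* §2 **`transportLeaf_assembled_mod_canonical`** [bookkeeping] — `transportLeaf_assembled_mod` with `rs := rsOf r ϱ`,
  `Asz := aszRec T.gen s (s1Mod r α T.gen c Sg δf)`, `s1 := s1Mod r α T.gen c Sg δf`: the SIX bookkeeping binders `hs1`/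
  `hAsz_birth`/`hAsz_step`/`hrs_birth`/`hrs_step`/`hrs_dec` are GONE (and the functions `s1`/`rs`/`Asz` leave the signature),
  replaced by the two schedule inequalities `hϱ_birth : ϱ f k″ k″ < r`, `hϱ_succ : ϱ f k″ (k+1) < ϱ f k″ k` (F-5's shrinking chart
  radii); `hmargin`'s last clause reads `ϱ₁ b k ≤ rsOf r ϱ p.1 p.2 k`; every other binder is END-F′-mod's VERBATIM.  Conclusion:
  VERBATIM the field type of `BookingLeaves.htr` (`C = 4c_δ/r`, `ρ i = ψ·α i`), as END-F/END-F′/END-F′-mod.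
The same two-line substitution serves the per-step-window siblings of the moduli face (leaf-08's END-F′-mod-win, leaf-04's
slice-window cure of finding F-ne1pleaf04-1) once they are in the tree — not done here.

HONEST FRAMING.  Rung (B)+1 bookkeeping on ONE finite four-torus of fixed physical size — NOT infinite volume, NOT a mass gap, NOT
OS on ℝ⁴, NOT the Clay problem, NOT summit progress.  NE1′ is NOT PRINTED and NOT PROVED; headline «L-T ⇐ F-1, F-2 (+ the H2
dictionary `hQ`/`hSg`), F-3, F-5…F-9 on the moduli face, with no bookkeeping functions displayed», never «NE1′ proved»; every wall
binder of `t4/T4-EST-NE1p-P1.md` §4 stays DISPLAYED ((w1) `hsl`, (w2-act) `hB`/`hE` — printed TYPE [Balaban1989LargeFieldII] (1.65)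
p. 375, (1.71)–(1.75) pp. 379–380, asserted for Bałaban's densities NOWHERE —, (w3)⁺ nesting incl. the cross-family margins at the
UNIFORM slice window `w` (finding F-ne1pleaf04-1 = LF-2 applies to this face exactly as to END-F′-mod), (w4) `hdom`, (I4′) `hrate`/
`hδf`, attainment, invariance); 0 binders are instantiated on Bałaban's densities; the data defined here are bookkeeping functions
of HYPOTHESISED inputs, no `def … : Prop`; [folklore] kernel glue, 0 sorry, 0 citations used as hypothesis-free facts.  Spine
PROVED 0∕9 unchanged.  HONEST DEPENDENCY: continuum YM on T⁴ ⇐ BetaPertH ∧ nine spine estimates (0/9 proved); BetaPertH ⇐ (D1) ∧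
(D4) ∧ CAP+tail; G-an2-4 gates asym, D1 and NE2/3/4.
-/

noncomputable section

namespace Summit.QuantumFields.BalabanUV.T4Continuum.NE1p.DressedTransportAssembledModData

open MeasureTheory Set Metric Filter Finset
open scoped BigOperators
open Literature.MathematicalPhysics.QuantumFieldTheory.Balaban1983to89
open Literature.MathematicalPhysics.QuantumFieldTheory.Balaban1983to89.T4TermFormat
open Literature.MathematicalPhysics.QuantumFieldTheory.Balaban1983to89.T4TermFormat.Booking
open Literature.MathematicalPhysics.QuantumFieldTheory.Balaban1983to89.T4GatedBooking
open Literature.MathematicalPhysics.QuantumFieldTheory.Balaban1983to89.T4TrajectoryComparison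
open Literature.MathematicalPhysics.QuantumFieldTheory.Balaban1983to89.T4TrajectoryModulus
open Summit.QuantumFields.BalabanUV.T4Continuum.T4TrajectoryDensityDressed
open Summit.QuantumFields.BalabanUV.T4Continuum.NE1p.DressedRoot
open Summit.QuantumFields.BalabanUV.T4Continuum.NE1p.DressedTransportAssembled
open Summit.QuantumFields.BalabanUV.T4Continuum.NE1p.DressedTransportAssembledData
open Summit.QuantumFields.BalabanUV.T4Continuum.NE1p.DressedTransportAssembledMod
open T4BirthChartTransport (GaugeInvariant BirthSlice RelGauge)
open T4BlockTransport (Fld NDir latMove latN latMove_zero)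
open T4TrajectoryDensity

/-! ## §1 The canonical size and budget functions of the moduli face [data] and their defining equations [arith] -/

section Data

variable {B : T4TermFormat.Booking}

variable (gen : B.Birth → ℕ → ℝ) (s s1 : B.Birth → ℕ → ℝ)

/-- **CURRENT SLICE SIZE OF A GENERATION, PLAIN RECURSION** [data]: the generation `(f, k″)` has its birth size `gen f k″` at
(and formally before) its own scale, and is multiplied by the step cost `e^{3(s f k + s1 f k)}` at every later dressed step
`k → k+1`.  Both budget functions are GIVEN (on the moduli face the step budget `s1` is a closed form), so no joint recursion is
needed.  Bookkeeping only. [folklore] -/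
def aszRec (f : B.Birth) (k'' : ℕ) : ℕ → ℝ
  | 0 => gen f k''
  | k + 1 => if k + 1 ≤ k'' then gen f k'' else Real.exp (3 * (s f k + s1 f k)) * aszRec f k'' k

/-- At (and formally before) its own scale a generation has its birth size. [arith] [folklore] -/
theorem aszRec_of_le (f : B.Birth) {k'' k : ℕ} (h : k ≤ k'') : aszRec gen s s1 f k'' k = gen f k'' := by
  cases k with
  | zero => rfl
  | succ k =>
    show (if k + 1 ≤ k'' then gen f k'' else Real.exp (3 * (s f k + s1 f k)) * aszRec gen s s1 f k'' k) = _
    rw [if_pos h]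

/-- `Asz f k″ k″ = gen f k″` — END-F′-mod's `hAsz_birth`. [arith] [folklore] -/
theorem aszRec_birth (f : B.Birth) (k'' : ℕ) : aszRec gen s s1 f k'' k'' = gen f k'' :=
  aszRec_of_le gen s s1 f le_rfl

/-- `Asz f k″ (k+1) = e^{3(s f k + s1 f k)}·Asz f k″ k` for `k″ ≤ k` — END-F′-mod's `hAsz_step`. [arith] [folklore] -/
theorem aszRec_succ (f : B.Birth) {k'' k : ℕ} (h : k'' ≤ k) :
    aszRec gen s s1 f k'' (k + 1) = Real.exp (3 * (s f k + s1 f k)) * aszRec gen s s1 f k'' k := by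
  show (if k + 1 ≤ k'' then gen f k'' else Real.exp (3 * (s f k + s1 f k)) * aszRec gen s s1 f k'' k) = _
  rw [if_neg (by omega)]

variable (r : ℝ) (α : ℕ → ℝ) (c : B.Birth → ℕ → ℂ) (Sg : ℕ → B.Birth → Finset (B.Birth × ℕ))
  (δf : B.Birth → ℕ → B.Birth × ℕ → ℝ)

/-- **FUNCTION-LEVEL FRESH BUDGET OF A MET COMPONENT, MODULUS FORM** [data]: `s1 b k := ‖c b k‖·Σ_{p ∈ Sg k b}
(4/r·stepProd α p.2 k·gen p.1 p.2)·δf b k p` — the source factor times the live generations' transported RESPONSE MODULI times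
their transverse fresh defects; END-F′-mod's `hs1` as a definition.  Bookkeeping only. [folklore] -/
def s1Mod (b : B.Birth) (k : ℕ) : ℝ :=
  ‖c b k‖ * ∑ p ∈ Sg k b, (4 / r * stepProd α p.2 k * gen p.1 p.2) * δf b k p

/-- The defining equation of `s1Mod` — END-F′-mod's `hs1`. [arith] [folklore] -/
theorem s1Mod_eq (b : B.Birth) (k : ℕ) :
    s1Mod gen r α c Sg δf b k = ‖c b k‖ * ∑ p ∈ Sg k b, (4 / r * stepProd α p.2 k * gen p.1 p.2) * δf b k p :=
  rfl

end Data

/-! ## §2 END-F′-mod over the canonical data [bookkeeping] -/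

section FunctionLevel

variable {B : T4TermFormat.Booking} {T : Trajectory B}
variable {R : Type*} [NormedRing R] [NormedAlgebra ℂ R] [MeasurableSpace R] {d : ℕ}

/-- The schedule inequalities (`ϱ f k″ k″ < r` at birth, `ϱ f k″ (k+1) < ϱ f k″ k` afterwards) give END-F′-mod's ordering
`hrs_dec : ϱ f k″ k < rs f k″ k` for the canonical radius `rs := rsOf r ϱ`. [arith] [folklore] -/
theorem rsOf_dec {r : ℝ} {ϱ : B.Birth → ℕ → ℕ → ℝ}
    (hϱ_birth : ∀ (f : B.Birth) (k'' : ℕ), B.birthScale f ≤ k'' → ϱ f k'' k'' < r)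
    (hϱ_succ : ∀ (f : B.Birth) (k'' k : ℕ), B.birthScale f ≤ k'' → k'' ≤ k → ϱ f k'' (k + 1) < ϱ f k'' k) :
    ∀ (f : B.Birth) (k'' k : ℕ), B.birthScale f ≤ k'' → k'' ≤ k → ϱ f k'' k < rsOf r ϱ f k'' k := by
  intro f k'' k hf hk''
  rcases Nat.lt_or_eq_of_le hk'' with hlt | heq
  · obtain ⟨k₀, rfl⟩ : ∃ k₀, k = k₀ + 1 := ⟨k - 1, by omega⟩
    have hk₀ : k'' ≤ k₀ := Nat.lt_succ_iff.mp hlt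
    rw [rsOf_succ r ϱ f hk₀]
    exact hϱ_succ f k'' k₀ hf hk₀
  · subst heq
    rw [rsOf_birth]
    exact hϱ_birth f k'' hf

/-- **END-F′-mod OVER THE CANONICAL DATA — THE TRANSPORT LEAF `htr` OF `BookingLeaves` ON THE MODULI FACE WITH NO BOOKKEEPING
FUNCTIONS DISPLAYED** [bookkeeping]: leaf-08's `DressedTransportAssembledMod.transportLeaf_assembled_mod` (END-F′-mod) with
`rs := rsOf r ϱ`, `Asz := aszRec T.gen s (s1Mod T.gen r α c Sg δf)`, `s1 := s1Mod T.gen r α c Sg δf`; its six bookkeeping binders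
`hs1`/`hAsz_birth`/`hAsz_step`/`hrs_birth`/`hrs_step`/`hrs_dec` are §1's lemmas + `rsOf_dec`, so they DISAPPEAR together with the
free functions `s1`/`rs`/`Asz`; the schedule enters through `hϱ_birth : ϱ f k″ k″ < r` and `hϱ_succ : ϱ f k″ (k+1) < ϱ f k″ k`
only.  Displayed binders: END-F's wall items (F-1 `hsl`; F-2 `hFn`/`h𝒢` and the H2 dictionary `hQ`/`hSg`; F-3 `hB`/`hE`; F-5
`hN1`/`hN2`/`hdiam`/`hθ`/`hN1x`/`hN2cx`/`hmargin` (over `rsOf r ϱ`)/`hϱ_birth`/`hϱ_succ`; F-6 `hrate`/`hdefw`/`hδf`/`hδfw`/`hpairx`;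
F-7 `hdom`; F-8 `hlin`; F-9 `hα`/`hr`/`hw`/`hcδ`/`hψ`/`hD`/`hϱ`/`hDμ`; measurability `hmeas`; invariance `hinv`) and the ONE
cutoff-free scalar condition `hcm : ‖c b k‖ ≤ m`.  NO `hP`, NO `hs`, NO budget binder, NO radius floor, NO bookkeeping equality.
The cross-family margins `hN2cx`/`hpairx` keep the UNIFORM slice window `w` (finding F-ne1pleaf04-1 = LF-2 applies verbatim).
Conclusion: EXACTLY the field `htr` of `BookingLeaves` (`C = 4c_δ/r`, `ρ i = ψ·α i`).  Nothing of Bałaban's densities is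
asserted. [folklore] -/
theorem transportLeaf_assembled_mod_canonical {Fn : B.Birth → ℕ → ℕ → Fld d R → ℂ}
    {rel : B.Birth → ℕ → ℕ → Fld d R → Fld d R → Prop} {𝒦 : B.Birth → ℕ → ℕ → Set (Fld d R)}
    {ref : B.Birth → ℕ → Fld d R → Fld d R} {base : B.Birth → ℕ → Fld d R → ℝ}
    {𝒜 𝒬 : B.Birth → ℕ → Fld d R → Fld d R → ℂ} {q : B.Birth → ℕ → Fld d R → ℂ}
    {μ : B.Birth → ℕ → Measure (Fld d R)} {z₀ z₁ : B.Birth → ℕ → Fld d R} {D : B.Birth → ℕ → Set (Fld d R)}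
    {defect : B.Birth → ℕ → ℕ → ℝ} {cδ ψ w r m : ℝ} {s θ ϱ₁ : B.Birth → ℕ → ℝ} {α : ℕ → ℝ}
    {ϱ : B.Birth → ℕ → ℕ → ℝ} {S : ℕ → B.Birth → Finset B.Birth}
    {Sg : ℕ → B.Birth → Finset (B.Birth × ℕ)} {c : B.Birth → ℕ → ℂ} {δf : B.Birth → ℕ → B.Birth × ℕ → ℝ}
    (hα : ∀ i, 0 ≤ α i) (hr : 0 < r) (hw : 0 < w) (hcδ : 0 ≤ cδ) (hψ : 0 ≤ ψ)
    (hsl : ∀ (b : B.Birth) (k' : ℕ), B.birthScale b ≤ k' → k' ≤ B.K →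
      RanBelow (budgetGate T s m S (4 * cδ / r) (fun i => ψ * α i)) k' →
      BirthSlice (Fn b k' k') latMove latN (𝒦 b k' k') w r (T.gen b k'))
    (hFn : ∀ (b : B.Birth) (k' k : ℕ), B.birthScale b ≤ k' → k' ≤ k → k + 1 ≤ B.K →
      RanBelow (budgetGate T s m S (4 * cδ / r) (fun i => ψ * α i)) (k + 1) →
      ∀ U, Fn b k' (k + 1) U =
        wOp (expWeight (base b k) (𝒜 b k + 𝒬 b k)) (μ b k) (z₀ b k) U (fun z => Fn b k' k (U + z)))
    (h𝒢 : ∀ (b : B.Birth) (k' k : ℕ), B.birthScale b ≤ k' → k' ≤ k → k + 1 ≤ B.K →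
      RanBelow (budgetGate T s m S (4 * cδ / r) (fun i => ψ * α i)) (k + 1) →
      ∀ U, (fun z => Fn b k' k (U + z)) ∈ BddClass ℂ (μ b k))
    (hD : ∀ b k, (D b k).Nonempty) (hϱ : ∀ b k' k, 0 < ϱ b k' k)
    (hB : ∀ (b : B.Birth) (k' k : ℕ), B.birthScale b ≤ k' → k' ≤ k → k + 1 ≤ B.K →
      RanBelow (budgetGate T s m S (4 * cδ / r) (fun i => ψ * α i)) (k + 1) →
      RealBaseAt (ref b k) (base b k) (𝒜 b k) (μ b k) (𝒦 b k' (k + 1)))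
    (hE : ∀ (b : B.Birth) (k' k : ℕ), B.birthScale b ≤ k' → k' ≤ k → k + 1 ≤ B.K →
      RanBelow (budgetGate T s m S (4 * cδ / r) (fun i => ψ * α i)) (k + 1) →
      ExponentSliceAt (ref b k) (𝒜 b k) (μ b k) latMove latN (𝒦 b k' (k + 1)) w (ϱ b k' k) (s b k))
    -- the Assembly's dictionary: the centred observable-attached exponent IS the fresh sum over the live generations
    (hQ : ∀ b k, (fun U z => 𝒬 b k U z - q b k U) =
      fun U z => c b k * ∑ p ∈ Sg k b, (Fn p.1 p.2 k (U + z) - Fn p.1 p.2 k (U + z₁ b k)))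
    (hSg : ∀ k b, ∀ p ∈ Sg k b, p.1 ∈ S k b ∧ B.birthScale p.1 ≤ p.2 ∧ p.2 ≤ k)
    -- the schedule: shrinking chart radii (F-5), below the birth radius from the start
    (hϱ_birth : ∀ (f : B.Birth) (k'' : ℕ), B.birthScale f ≤ k'' → ϱ f k'' k'' < r)
    (hϱ_succ : ∀ (f : B.Birth) (k'' k : ℕ), B.birthScale f ≤ k'' → k'' ≤ k → ϱ f k'' (k + 1) < ϱ f k'' k)
    (hmargin : ∀ (b : B.Birth) (k' k : ℕ), B.birthScale b ≤ k' → k' ≤ k →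
      ϱ b k' k < ϱ₁ b k ∧ 0 < ϱ₁ b k ∧ ∀ p ∈ Sg k b, ϱ₁ b k ≤ rsOf r ϱ p.1 p.2 k)
    -- the cutoff-free source-vs-budget condition
    (hcm : ∀ b k, ‖c b k‖ ≤ m)
    (hδf : ∀ b k, ∀ p ∈ Sg k b, 0 ≤ δf b k p ∧ δf b k p ≤ cδ * ψ ^ (k - p.2))
    (hδfw : ∀ b k, ∀ p ∈ Sg k b, δf b k p ≤ w)
    (hDμ : ∀ b k, ∀ᵐ z ∂μ b k, z ∈ D b k)
    (hN1 : ∀ (b : B.Birth) (k' k : ℕ), B.birthScale b ≤ k' → k' ≤ k → k + 1 ≤ B.K →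
      ∀ z ∈ D b k, ∀ U ∈ 𝒦 b k' (k + 1), U + z ∈ 𝒦 b k' k)
    (hN2 : ∀ (b : B.Birth) (k' k : ℕ), B.birthScale b ≤ k' → k' ≤ k → k + 1 ≤ B.K →
      ∀ U₀ ∈ 𝒦 b k' (k + 1), ∀ p : NDir d R, latN p ≤ w → ∀ z' ∈ D b k, latMove U₀ p 1 + z' ∈ 𝒦 b k' k)
    (hN1x : ∀ (b : B.Birth) (k' k : ℕ), B.birthScale b ≤ k' → k' ≤ k →
      ∀ p ∈ Sg k b, ∀ z ∈ D b k, ∀ U ∈ 𝒦 b k' (k + 1), U + z ∈ 𝒦 p.1 p.2 k)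
    (hN2cx : ∀ (b : B.Birth) (k' k : ℕ), B.birthScale b ≤ k' → k' ≤ k →
      ∀ p ∈ Sg k b, ∀ U₀ ∈ 𝒦 b k' (k + 1), ∀ pd : NDir d R, 0 < latN pd → latN pd ≤ w →
        ∀ t ∈ tube (ϱ₁ b k / latN pd), latMove U₀ pd t + z₁ b k ∈ 𝒦 p.1 p.2 k)
    (hpairx : ∀ (b : B.Birth) (k' k : ℕ), B.birthScale b ≤ k' → k' ≤ k →
      ∀ p ∈ Sg k b, ∀ U₀ ∈ 𝒦 b k' (k + 1), ∀ pd : NDir d R, 0 < latN pd → latN pd ≤ w →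
        ∀ᵐ z ∂μ b k, ∀ t ∈ tube (ϱ₁ b k / latN pd),
          RelGauge (rel p.1 p.2 k) latMove latN (latMove U₀ pd t + z₁ b k) (latMove U₀ pd t + z) (δf b k p))
    (hdiam : ∀ b k, ∀ z ∈ D b k, ∀ z' ∈ D b k, ∀ x ν, ‖z x ν - z' x ν‖ ≤ θ b k)
    (hθ : ∀ b k, 0 < θ b k ∧ θ b k ≤ w)
    (hdom : ∀ (b : B.Birth) (k' k : ℕ), B.birthScale b ≤ k' → k' ≤ k → k + 1 ≤ B.K →
      Real.exp 3 * (1 + 4 * θ b k / ϱ b k' k) ≤ α k)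
    (hinv : ∀ b k' k, GaugeInvariant (rel b k' k) (Fn b k' k))
    (hmeas : ∀ (b f : B.Birth) (k'' k : ℕ) (U : Fld d R), AEStronglyMeasurable (fun z => Fn f k'' k (U + z)) (μ b k))
    (hdefw : ∀ b k' k, defect b k' k ≤ w)
    (hrate : ∀ (b : B.Birth) (k' k : ℕ), B.birthScale b ≤ k' → k' ≤ k → k ≤ B.K →
      defect b k' k ≤ cδ * ψ ^ (k - k'))
    (hlin : ∀ (b : B.Birth) (k' k : ℕ), B.birthScale b ≤ k' → k' ≤ k → k ≤ B.K →
      RanBelow (budgetGate T s m S (4 * cδ / r) (fun i => ψ * α i)) k → ∀ ε > 0,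
      ∃ U₀ ∈ 𝒦 b k' k, ∃ U₁ : Fld d R, RelGauge (rel b k' k) latMove latN U₀ U₁ (defect b k' k) ∧
        T.lin b k' k ≤ ‖Fn b k' k U₁ - Fn b k' k U₀‖ + ε) :
    T.TransportsFromVar (4 * cδ / r) (fun i => ψ * α i) (budgetGate T s m S (4 * cδ / r) (fun i => ψ * α i)) :=
  transportLeaf_assembled_mod (rs := rsOf r ϱ) (Asz := aszRec T.gen s (s1Mod T.gen r α c Sg δf))
    (s1 := s1Mod T.gen r α c Sg δf) hα hr hw hcδ hψ hsl hFn h𝒢 hD hϱ hB hE hQ hSg (s1Mod_eq T.gen r α c Sg δf)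
    (aszRec_birth T.gen s (s1Mod T.gen r α c Sg δf)) (rsOf_birth r ϱ)
    (fun f _ _ _ hk => aszRec_succ T.gen s (s1Mod T.gen r α c Sg δf) f hk) (fun f _ _ _ hk => rsOf_succ r ϱ f hk)
    (rsOf_dec hϱ_birth hϱ_succ) hmargin hcm hδf hδfw hDμ hN1 hN2 hN1x hN2cx hpairx hdiam hθ hdom hinv hmeas hdefw hrate hlin

end FunctionLevel

end Summit.QuantumFields.BalabanUV.T4Continuum.NE1p.DressedTransportAssembledModData

end
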